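import Summits.ResolutionOfSingularities.ResolutionOfSingularities.Theorems.HilbertSamuelEliminationSigmaMaxModificationsCorridor3CPFramePropagationMenuChain
import HarnessLib

/-!
# [OURS · L1 W4.2] D18 `hread_menu`: the «equicharacteristic stalks» binder of `exists_isCPFrame_adapted_of_reachesσE_of_faces` DISCHARGED —
# along the canonical chain from a maximal origin (a scheme over a field) every natural number is `0` or a unit in every stalk
# (cell res-hironaka, LADDER-RESOLUTION rung L; slot W4.2, crux chain w42 `SigmaMaxModificationsCorridor3` stmt-ResolutionOfSingularities-19249;
# `--supports stmt-ResolutionOfSingularities-19249 --as helper`; hand res-D-brk-3 (gen 7), file F3d)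

SCHEME-SIDE BOOKKEEPING (universe `0`), 0 `def`s, every declaration PROVED; OURS; NOT a statement of Hironaka's manuscript [Hironaka2017] nor of
[CossartJannsenSaito2020]/[CossartPiltant2019]. AI-written, weaker than expert review.

* `natCast_eq_zero_or_isUnit_stalk_of_reachesσE` — from `IsMaximalOrigin` (the origin is a scheme over a field `k`) the stalk `𝒪_{X₀,x}` receives
  a ring map from `k`, so `n = 0` or a unit there; this persists along the stalk maps of the blow-ups.
* **`exists_isCPFrame_adapted_of_reachesσE_of_pointsCurves`** — for runs whose canonical centres at the marked points are POINTS or MEMBER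
  CURVES (`|K| ∈ {2,3}`): NO projected-minimality statement, NO characteristic binder — fully discharged modulo the initial frame and the face
  constraint (the point by `reading_of_face_univ`, member curves by the full-minimality face reading p552261).
* **`exists_isCPFrame_adapted_of_reachesσE_of_faces'`** — `…_of_faces` (p561150) with the binder `hchar` removed: E-adapted complete minimal
  CP frames with `δ ≥ 1` at every stage reached along `ReachesσE (Strategy.cjs R₀).withBoundary 3 ν`, given the initial frame, the FACE
  constraint on the canonical centres at the marked points, and the projected-minimality statement (CP 2019 Prop. 2.4 (2), inline).

References: CP 2019 Prop. 2.4, Prop. 2.7 [CossartPiltant2019]; CJS LNM 2270 Rem. 6.29 (1) [CossartJannsenSaito2020].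
-/

noncomputable section

set_option linter.dupNamespace false

open CategoryTheory AlgebraicGeometry TopologicalSpace IsLocalRing Polynomial
open Literature.AlgebraicGeometry.Resolution Literature.RingTheory.HilbertSamuel
open Summit.ResolutionOfSingularities.ResolutionOfSingularities.Theorems.CampaignW42
open Summit.ResolutionOfSingularities.ResolutionOfSingularities.Theorems.SigmaMaxModificationsCorridor3.Sigma
open Summit.ResolutionOfSingularities.ResolutionOfSingularities.Theorems.SigmaMaxModificationsCorridor3.Helpers

namespace Summit.ResolutionOfSingularities.ResolutionOfSingularities.Theorems.SigmaMaxModificationsCorridor3.Moving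

/-- A ring receiving a homomorphism from a field has every natural number `0` or a unit. [folklore] -/
theorem natCast_eq_zero_or_isUnit_of_ringHom_field {k A : Type*} [Field k] [CommRing A] (ρ : k →+* A) (n : ℕ) :
    (n : A) = 0 ∨ IsUnit (n : A) := by
  rcases eq_or_ne (n : k) 0 with h0 | hne
  · left; rw [← map_natCast ρ n, h0, map_zero]
  · right; rw [← map_natCast ρ n]; exact (hne.isUnit).map ρ

/-- The property «every natural number is `0` or a unit» passes along ring homomorphisms. [folklore] -/
theorem natCast_eq_zero_or_isUnit_of_ringHom {A B : Type*} [CommRing A] [CommRing B] (ρ : A →+* B)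
    (hA : ∀ n : ℕ, (n : A) = 0 ∨ IsUnit (n : A)) (n : ℕ) : (n : B) = 0 ∨ IsUnit (n : B) := by
  rcases hA n with h0 | hu
  · left; rw [← map_natCast ρ n, h0, map_zero]
  · right; rw [← map_natCast ρ n]; exact hu.map ρ

/-- [OURS · L1 W4.2] **Stalks along the canonical chain from a maximal origin are equicharacteristic**: every natural number is `0` or a unit in
`𝒪_{X_n, x_n}`. [folklore] -/
theorem natCast_eq_zero_or_isUnit_stalk_of_reachesσE {p : ℕ} {R₀ : ∀ S : Scheme.{0}, CentreSeq S → Prop} {ν : ℕ → ℕ}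
    {X₀ : Scheme.{0}} [IsLocallyNoetherian X₀] {x : X₀} (hX : IsMaximalOrigin p 3 ν X₀ x) (E₀ : Boundary X₀)
    {s : MarkedStageE.{0}} (hs : ReachesσE (Strategy.cjs R₀).withBoundary 3 ν (MarkedStageE.init X₀ x E₀) s) (n : ℕ) :
    (n : (s.W.presheaf.stalk s.pt : Type)) = 0 ∨ IsUnit (n : (s.W.presheaf.stalk s.pt : Type)) := by
  induction hs generalizing n with
  | refl =>
    obtain ⟨k, _, _, f, -, -, -⟩ := hX.exists_structure
    -- `k → Γ(Spec k) → Γ(X₀) → 𝒪_{X₀,x}`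
    let ρ : k →+* (X₀.presheaf.stalk x : Type) :=
      (X₀.presheaf.germ ⊤ x trivial).hom.comp ((f.appTop).hom.comp (Scheme.ΓSpecIso (.of k)).inv.hom)
    exact natCast_eq_zero_or_isUnit_of_ringHom_field ρ n
  | tail _ hstep ih =>
    obtain ⟨C, P', hln', x', -, hx', -, -, rfl⟩ := hstep
    have ih' : ∀ n : ℕ, (n : ((blowup C).presheaf.stalk x' : Type)) = 0 ∨ IsUnit (n : ((blowup C).presheaf.stalk x' : Type)) := by
      intro n
      refine natCast_eq_zero_or_isUnit_of_ringHom ((blowup.π C).stalkMap x').hom (fun n => ?_) n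
      rw [hx']
      exact ih n
    exact ih' n

/-- [OURS · L1 W4.2] **`hread_menu` DISCHARGED, equicharacteristic binder removed.** As `exists_isCPFrame_adapted_of_reachesσE_of_faces` without `hchar`.
[cite: CossartPiltant2019, Def. 2.6–2.7, Prop. 2.3–2.4, Prop. 2.7 (arXiv v1 pp. 11–14)] [cite: CossartJannsenSaito2020, Def. 3.1, Rem. 6.29 (1)] -/
theorem exists_isCPFrame_adapted_of_reachesσE_of_faces' {p : ℕ} {R₀ : ∀ S : Scheme.{0}, CentreSeq S → Prop}
    (hRf : OracleFunctional R₀) (hRa : OracleAdmissible R₀) {ν : ℕ → ℕ} {X₀ : Scheme.{0}} [IsLocallyNoetherian X₀] {x : X₀}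
    (hX : IsMaximalOrigin p 3 ν X₀ x) (E₀ : Boundary X₀)
    (hproj : ∀ (R : Type) (_ : CommRing R) (_ : IsRegularLocalRing R) (u : Fin 3 → R) (h : R[X]),
      Ideal.span (Set.range u) = maximalIdeal R → h.Monic → CossartPiltant.IsMinimal u h →
      ∀ T : Finset (Fin 3), CossartPiltant.IsMinimal (u ∘ (fun i => T.orderEmbOfFin rfl i)) h)
    (hface : ∀ s : MarkedStageE.{0}, ReachesσE (Strategy.cjs R₀).withBoundary 3 ν (MarkedStageE.init X₀ x E₀) s →
      ∀ (C : s.W.IdealSheafData) (P' : Option (Pending (blowup C))), IsCanonicalStep R₀ 3 ν s.L s.P C P' →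
      IdealSheafData.IsPermissibleAt C s.pt ∧
      ∃ K : Finset s.W.IdealSheafData, (∀ I ∈ K, I ∈ membersThrough s.E s.pt ∧ stalkIdeal I s.pt ≤ stalkIdeal C s.pt) ∧
        (∀ I ∈ K, ∀ I' ∈ K, stalkIdeal I s.pt = stalkIdeal I' s.pt → I = I') ∧
        ringKrullDim ((s.W.presheaf.stalk s.pt : Type) ⧸ stalkIdeal C s.pt) + K.card = 3)
    (h0 : ∃ (R : Type) (_ : CommRing R) (_ : IsLocalRing R) (u : Fin 3 → R) (h : R[X])
      (φ : ((MarkedStageE.init X₀ x E₀).W.presheaf.stalk (MarkedStageE.init X₀ x E₀).pt : Type) →+* R[X] ⧸ Ideal.span {h})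
      (e : (MarkedStageE.init X₀ x E₀).W.IdealSheafData → Fin 3),
      IsCPFrame (MarkedStageE.init X₀ x E₀).toMarkedStage R u h φ ∧ IsAdicComplete (maximalIdeal R) R ∧
      (∀ i < h.natDegree, h.coeff i ∈ maximalIdeal R ^ (h.natDegree - i)) ∧
      ∀ I ∈ membersThrough (MarkedStageE.init X₀ x E₀).E (MarkedStageE.init X₀ x E₀).pt,
        (stalkIdeal I (MarkedStageE.init X₀ x E₀).pt).map φ = Ideal.span {Ideal.Quotient.mk _ (Polynomial.C (u (e I)))})
    {s : MarkedStageE.{0}} (hs : ReachesσE (Strategy.cjs R₀).withBoundary 3 ν (MarkedStageE.init X₀ x E₀) s) :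
    ∃ (R : Type) (_ : CommRing R) (_ : IsLocalRing R) (u : Fin 3 → R) (h : R[X])
      (φ : (s.W.presheaf.stalk s.pt : Type) →+* R[X] ⧸ Ideal.span {h}) (e : s.W.IdealSheafData → Fin 3),
      IsCPFrame s.toMarkedStage R u h φ ∧ IsAdicComplete (maximalIdeal R) R ∧
      (∀ i < h.natDegree, h.coeff i ∈ maximalIdeal R ^ (h.natDegree - i)) ∧
      ∀ I ∈ membersThrough s.E s.pt, (stalkIdeal I s.pt).map φ = Ideal.span {Ideal.Quotient.mk _ (Polynomial.C (u (e I)))} :=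
  exists_isCPFrame_adapted_of_reachesσE_of_faces hRf hRa hX E₀ (fun _ hs₁ => natCast_eq_zero_or_isUnit_stalk_of_reachesσE hX E₀ hs₁)
    hproj hface h0 hs

/-- [OURS · L1 W4.2] **`hread_menu` DISCHARGED UNCONDITIONALLY for runs whose canonical centres at the marked points are POINTS or MEMBER CURVES**
(`|K| ∈ {2, 3}`): no projected-minimality statement and no characteristic binder are needed — the point is read by `IsCPFrame.reading_of_face_univ`
and a member curve by `IsCPFrame.exists_reading_of_face_two` (full minimality of the CP frame, p552261).
[cite: CossartPiltant2019, Def. 2.6–2.7, Prop. 2.3, Prop. 2.7 (arXiv v1 pp. 11–14)] [cite: CossartJannsenSaito2020, Def. 3.1, Rem. 6.29 (1)] -/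
theorem exists_isCPFrame_adapted_of_reachesσE_of_pointsCurves {p : ℕ} {R₀ : ∀ S : Scheme.{0}, CentreSeq S → Prop}
    (hRf : OracleFunctional R₀) (hRa : OracleAdmissible R₀) {ν : ℕ → ℕ} {X₀ : Scheme.{0}} [IsLocallyNoetherian X₀] {x : X₀}
    (hX : IsMaximalOrigin p 3 ν X₀ x) (E₀ : Boundary X₀)
    (hface : ∀ s : MarkedStageE.{0}, ReachesσE (Strategy.cjs R₀).withBoundary 3 ν (MarkedStageE.init X₀ x E₀) s →
      ∀ (C : s.W.IdealSheafData) (P' : Option (Pending (blowup C))), IsCanonicalStep R₀ 3 ν s.L s.P C P' →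
      IdealSheafData.IsPermissibleAt C s.pt ∧
      ∃ K : Finset s.W.IdealSheafData, (K.card = 2 ∨ K.card = 3) ∧
        (∀ I ∈ K, I ∈ membersThrough s.E s.pt ∧ stalkIdeal I s.pt ≤ stalkIdeal C s.pt) ∧
        (∀ I ∈ K, ∀ I' ∈ K, stalkIdeal I s.pt = stalkIdeal I' s.pt → I = I') ∧
        ringKrullDim ((s.W.presheaf.stalk s.pt : Type) ⧸ stalkIdeal C s.pt) + K.card = 3)
    (h0 : ∃ (R : Type) (_ : CommRing R) (_ : IsLocalRing R) (u : Fin 3 → R) (h : R[X])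
      (φ : ((MarkedStageE.init X₀ x E₀).W.presheaf.stalk (MarkedStageE.init X₀ x E₀).pt : Type) →+* R[X] ⧸ Ideal.span {h})
      (e : (MarkedStageE.init X₀ x E₀).W.IdealSheafData → Fin 3),
      IsCPFrame (MarkedStageE.init X₀ x E₀).toMarkedStage R u h φ ∧ IsAdicComplete (maximalIdeal R) R ∧
      (∀ i < h.natDegree, h.coeff i ∈ maximalIdeal R ^ (h.natDegree - i)) ∧
      ∀ I ∈ membersThrough (MarkedStageE.init X₀ x E₀).E (MarkedStageE.init X₀ x E₀).pt,
        (stalkIdeal I (MarkedStageE.init X₀ x E₀).pt).map φ = Ideal.span {Ideal.Quotient.mk _ (Polynomial.C (u (e I)))})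
    {s : MarkedStageE.{0}} (hs : ReachesσE (Strategy.cjs R₀).withBoundary 3 ν (MarkedStageE.init X₀ x E₀) s) :
    ∃ (R : Type) (_ : CommRing R) (_ : IsLocalRing R) (u : Fin 3 → R) (h : R[X])
      (φ : (s.W.presheaf.stalk s.pt : Type) →+* R[X] ⧸ Ideal.span {h}) (e : s.W.IdealSheafData → Fin 3),
      IsCPFrame s.toMarkedStage R u h φ ∧ IsAdicComplete (maximalIdeal R) R ∧
      (∀ i < h.natDegree, h.coeff i ∈ maximalIdeal R ^ (h.natDegree - i)) ∧
      ∀ I ∈ membersThrough s.E s.pt, (stalkIdeal I s.pt).map φ = Ideal.span {Ideal.Quotient.mk _ (Polynomial.C (u (e I)))} := by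
  classical
  refine exists_isCPFrame_adapted_of_reachesσE hRf hRa hX E₀ (fun s₁ hs₁ C P' hcs R _ _ u h φ e hF hcpl hco hE => ?_) h0 hs
  obtain ⟨hperm, K, hK23, hK, hKinj, hdimK⟩ := hface s₁ hs₁ C P' hcs
  have hF' := hF
  obtain ⟨hR, hloc, hdim, hu, hmon, hφl, hflat, hmap, -, hmin⟩ := hF'
  haveI := hR
  haveI : IsLocalRing (AdjoinRoot h) := hloc
  haveI : IsLocallyNoetherian s₁.W := s₁.ln
  letI algφ : Algebra (s₁.W.presheaf.stalk s₁.pt : Type) (R[X] ⧸ Ideal.span {h}) := φ.toAlgebra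
  haveI : Module.Flat (s₁.W.presheaf.stalk s₁.pt : Type) (R[X] ⧸ Ideal.span {h}) := hflat
  haveI : IsLocalHom (algebraMap (s₁.W.presheaf.stalk s₁.pt : Type) (R[X] ⧸ Ideal.span {h})) := hφl
  haveI : Module.FaithfullyFlat (s₁.W.presheaf.stalk s₁.pt : Type) (R[X] ⧸ Ideal.span {h}) := Module.FaithfullyFlat.of_flat_of_isLocalHom
  set T : Finset (Fin 3) := K.image e with hTdef
  have heinj : Set.InjOn e ↑K := by
    intro I hI I' hI' hee
    apply hKinj I (Finset.mem_coe.mp hI) I' (Finset.mem_coe.mp hI')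
    have h1 := hE I (hK I (Finset.mem_coe.mp hI)).1
    have h2 := hE I' (hK I' (Finset.mem_coe.mp hI')).1
    rw [← Ideal.comap_map_eq_self_of_faithfullyFlat (B := R[X] ⧸ Ideal.span {h}) (stalkIdeal I s₁.pt),
      ← Ideal.comap_map_eq_self_of_faithfullyFlat (B := R[X] ⧸ Ideal.span {h}) (stalkIdeal I' s₁.pt)]
    change (Ideal.map φ (stalkIdeal I s₁.pt)).comap φ = (Ideal.map φ (stalkIdeal I' s₁.pt)).comap φ
    rw [h1, h2, hee]
  have hTcard : T.card = K.card := Finset.card_image_of_injOn heinj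
  have hT : ∀ t ∈ T, Ideal.Quotient.mk (Ideal.span {h}) (Polynomial.C (u t)) ∈ (stalkIdeal C s₁.pt).map φ := by
    intro t ht
    obtain ⟨I, hIK, rfl⟩ := Finset.mem_image.mp ht
    have h1 := hE I (hK I hIK).1
    exact Ideal.map_mono (hK I hIK).2 (h1 ▸ Ideal.mem_span_singleton_self _)
  have hdimC : ringKrullDim ((s₁.W.presheaf.stalk s₁.pt : Type) ⧸ stalkIdeal C s₁.pt) + T.card = 3 := by rw [hTcard]; exact hdimK
  rcases hK23 with hK2 | hK3
  · -- a member curve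
    exact ⟨T, hF.exists_reading_of_face_two (hF.natCast_eq_zero_or_isUnit hco (natCast_eq_zero_or_isUnit_stalk_of_reachesσE hX E₀ hs₁))
      hco C hperm T (hTcard.trans hK2) hT hdimC⟩
  · -- the point
    have hdim0 : ringKrullDim ((s₁.W.presheaf.stalk s₁.pt : Type) ⧸ stalkIdeal C s₁.pt) = 0 := by
      have hpermI : (stalkIdeal C s₁.pt).IsPermissible := hperm
      haveI : Nontrivial ((s₁.W.presheaf.stalk s₁.pt : Type) ⧸ stalkIdeal C s₁.pt) := Ideal.Quotient.nontrivial_iff.mpr hpermI.ne_top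
      haveI : IsLocalRing ((s₁.W.presheaf.stalk s₁.pt : Type) ⧸ stalkIdeal C s₁.pt) :=
        IsLocalRing.of_surjective' (Ideal.Quotient.mk _) Ideal.Quotient.mk_surjective
      obtain ⟨d, hd⟩ : ∃ d : ℕ, ringKrullDim ((s₁.W.presheaf.stalk s₁.pt : Type) ⧸ stalkIdeal C s₁.pt) = d :=
        exists_nat_eq_of_ne_bot_of_ne_top ringKrullDim_ne_bot ringKrullDim_ne_top
      rw [hd, hK3] at hdimK
      rw [hd]
      have : d + 3 = 3 := by exact_mod_cast hdimK
      exact_mod_cast (show d = 0 by omega)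
    exact ⟨Finset.univ, hF.reading_of_face_univ hco C hperm hdim0⟩

end Summit.ResolutionOfSingularities.ResolutionOfSingularities.Theorems.SigmaMaxModificationsCorridor3.Moving

end
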